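import Literature.AlgebraicGeometry.AbelianSchemes.PoincareSheafMulN
import HarnessLib

/-!
# `ker [n]_A^* = Â[n]` on the Poincaré sheaf: `[n]_{A_T}^*(1 × c)^*𝒫 ≅ 𝒪 ↔ cⁿ = 1`

Layer `Literature/AlgebraicGeometry/AbelianSchemes`, namespace `Literature.AlgebraicGeometry.AbelianSchemes.AbelianSchemeOver.DualPair`.
Cell `hodgecm-mathlib`, HECKE-LINK brick H2 file (ii), D6 (u4) («`K′ = ker π^* ⊆ Â[n]`», census
`B-provers/B-p20/g9/CENSUS-H2-DualPairOfQuotient.v2.B-p20g9.md` §3 (u4); B-p16 (g13)'s finding (K) «the scheme-theoretic stabiliser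
of `𝒩₁` is a subgroup of the constant `Â[n]`»).  THEOREMS ONLY; sequel of ★ (SYM-n) `PoincareSheafMulN`.

For an abelian scheme `A/S` over a reduced locally Noetherian base with a dual pair `D = (Â, 𝒫)` and the unit hypothesis
`hD : 𝒫|_{A × {ε_Â}} ≅ 𝒪`, and a `T`-valued point `c : T → Â` over `f : T → S`:

* `nonempty_pullbackP_one_iso_unit` — `(1_A × 1)^*𝒫 ≅ 𝒪_{A_T}` for the unit `T`-point (★ `nonempty_pullbackP_comp_unitSection_iso`);
* `eq_one_of_nonempty_pullbackP_iso_unit` — **`(1_A × c)^*𝒫 ≅ 𝒪 ⟹ c = 1`** (uniqueness in ★ `universal` against the trivial family);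
* `nonempty_pullback_mulN_pullbackP_iso_unit_of_pow_eq_one` — `cⁿ = 1 ⟹ [n]_{A_T}^*(1_A × c)^*𝒫 ≅ 𝒪` (★ (SYM-n));
* **`pow_eq_one_of_nonempty_pullback_mulN_pullbackP_iso_unit`** — `[n]_{A_T}^*(1_A × c)^*𝒫 ≅ 𝒪 ⟹ cⁿ = 1`: every `T`-valued point of
  `Â` whose class dies under `[n]_{A_T}^* = ψ_T^* ∘ π_T^*` (`ψ ≫ π = [n]_A`, ★ `quotientMk_comp_mulNDesc`) is `n`-torsion — the kernel
  of `π^* : Â → B̂` lies in `Â[n]` ([MumfordAV1970] §15 Thm. 1: `ker f̂` is the Cartier dual of `ker f ⊆ A[n]`); the form with an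
  explicit factorisation `ψ ≫ π = [n]_A` through any `S`-scheme `C` is `pow_eq_one_of_nonempty_pullback_factor_iso_unit` ((K2) of the
  (K)/(u4) plan);
* **`nonempty_pullback_pullbackP_mul_inv_iso_unit`** — the ⊗-DIFFERENCE (K1): for `T`-points `a, a′` of `Â` and any `h : X → A_T`
  (e.g. `h = π_T`), `h^*(1 × a)^*𝒫 ≅ h^*(1 × a′)^*𝒫 ⟹ h^*(1 × a·a′⁻¹)^*𝒫 ≅ 𝒪_X` (★ (P-⊗) and `M ⊗ M^∨ ≅ 𝒪`).

HC_CM is proved only modulo the 7 printed citations until rung 0 closes; nothing here is about HC.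

## References
* [MumfordAV1970] D. Mumford, *Abelian Varieties* (1970), §8 (iv) (p. 75), §15 Thm. 1 (p. 143).
* [MilneAV2008] J. S. Milne, *Abelian Varieties* (v2.00, 2008), I §8 pp. 36–37 (uniqueness in the universal property), I §9.
-/

noncomputable section

universe u

open CategoryTheory CategoryTheory.Limits AlgebraicGeometry MonoidalCategory CartesianMonoidalCategory
open scoped MonObj

-- `Scheme.Modules` / `SheafOfModules` are not reducible (as in Mathlib's `AlgebraicGeometry/Modules/Sheaf.lean`).
set_option backward.isDefEq.respectTransparency false

namespace Literature.AlgebraicGeometry.AbelianSchemes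

namespace AbelianSchemeOver

open Literature.AlgebraicGeometry.Motives Literature.AlgebraicGeometry.AbelianVarieties
  Literature.AlgebraicGeometry.Modules

variable {S : Scheme.{u}} {A : AbelianSchemeOver S}

namespace DualPair

variable (D : A.DualPair) {T : Scheme.{u}} (f : T ⟶ S)

/-- The underlying `S`-morphism of the unit `T`-valued point of `Â` is `T → S → Â` through the unit section.
[cite: MilneAV2008, I §8 pp. 36–37] -/
theorem one_left_eq : ((1 : Over.mk f ⟶ D.hat.X)).left = f ≫ D.hat.unitSection := by
  change (toUnit (Over.mk f) ≫ η[D.hat.X]).left = f ≫ D.hat.unitSection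
  rw [Over.comp_left, Over.toUnit_left]
  rfl

/-- **`(1_A × 1)^*𝒫 ≅ 𝒪_{A_T}`**: the unit `T`-point of `Â` classifies the trivial family (under the unit hypothesis `hD`).
[cite: MilneAV2008, I §8 pp. 36–37] -/
theorem nonempty_pullbackP_one_iso_unit
    (hD : Nonempty ((Scheme.Modules.pullback (unitHatSlice D)).obj D.P ≅ SheafOfModules.unit _)) :
    Nonempty (D.pullbackP f ((1 : Over.mk f ⟶ D.hat.X)).left (Over.w _) ≅ SheafOfModules.unit _) := by
  have hf : (f ≫ D.hat.unitSection) ≫ D.hat.X.hom = f := by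
    rw [Category.assoc, D.hat.unitSection_comp_hom, Category.comp_id]
  rw [D.pullbackP_congr f (D.one_left_eq f) (Over.w _) hf]
  exact D.nonempty_pullbackP_comp_unitSection_iso f hD hf

/-- **`(1_A × c)^*𝒫 ≅ 𝒪 ⟹ c = 1`**: a `T`-valued point of `Â` classifying the trivial family is the unit point (uniqueness in ★
`universal`, against the trivial rigidified family `𝒪_{A_T}`, which lies fibrewise in `Pic⁰` by ★ `isHomogeneous_unit`).
[cite: MilneAV2008, I §8 pp. 36–37] -/
theorem eq_one_of_nonempty_pullbackP_iso_unit
    (hD : Nonempty ((Scheme.Modules.pullback (unitHatSlice D)).obj D.P ≅ SheafOfModules.unit _))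
    (c : Over.mk f ⟶ D.hat.X) (hc : Nonempty (D.pullbackP f c.left (Over.w c) ≅ SheafOfModules.unit _)) : c = 1 := by
  -- the trivial rigidified family `𝒪` on `A_T`
  let 𝒪T : A.RigidifiedLineBundle f :=
    { L := SheafOfModules.unit _
      hasRank_one := hasRank_unit_one
      rigid := ⟨RigidifiedLineBundle.pullbackUnitIso _⟩ }
  have h𝒪 : 𝒪T.FibrewisePicZero := fun Ω _ _ t =>
    (isHomogeneous_iff_of_iso _ (RigidifiedLineBundle.pullbackUnitIso _)).2 (isHomogeneous_unit _)
  exact Over.OverMorphism.ext (D.eq_of_nonempty_iso f 𝒪T h𝒪 c.left ((1 : Over.mk f ⟶ D.hat.X)).left (Over.w c) (Over.w _)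
    hc (D.nonempty_pullbackP_one_iso_unit f hD))

variable [IsReduced S] [IsLocallyNoetherian S]

/-- **`cⁿ = 1 ⟹ [n]_{A_T}^*(1_A × c)^*𝒫 ≅ 𝒪`**: the `n`-torsion `T`-points of `Â` die under `[n]_{A_T}^*` (★ (SYM-n)
`nonempty_pullback_mulN_baseChange_pullbackP_iso`: `[n]_{A_T}^*(1_A × c)^*𝒫 ≅ (1_A × cⁿ)^*𝒫`). [cite: MumfordAV1970, §8 ((iv), p. 75) and §15 Thm. 1 (p. 143)] -/
theorem nonempty_pullback_mulN_pullbackP_iso_unit_of_pow_eq_one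
    (hD : Nonempty ((Scheme.Modules.pullback (unitHatSlice D)).obj D.P ≅ SheafOfModules.unit _))
    (c : Over.mk f ⟶ D.hat.X) (n : ℕ) (hc : c ^ n = 1) :
    Nonempty ((Scheme.Modules.pullback ((A.baseChange f).mulN n).left).obj (D.pullbackP f c.left (Over.w c)) ≅
      SheafOfModules.unit _) := by
  obtain ⟨e⟩ := D.nonempty_pullback_mulN_baseChange_pullbackP_iso hD f c n
  rw [D.pullbackP_congr f (congrArg Over.Hom.left hc) (Over.w _) (Over.w _)] at e
  exact (D.nonempty_pullbackP_one_iso_unit f hD).map fun i => e ≪≫ i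

/-- **`[n]_{A_T}^*(1_A × c)^*𝒫 ≅ 𝒪 ⟹ cⁿ = 1`** — the kernel of `[n]_A^*` on the Poincaré families is `Â[n]`; since `ψ ≫ π = [n]_A`
(★ `quotientMk_comp_mulNDesc`), every `T`-valued point `c` of `Â` with `π_T^*(1_A × c)^*𝒫` trivial on `(A/K)_T` is `n`-torsion:
«`ker π^* ⊆ Â[n]`», the finiteness half of [MumfordAV1970] §15 Thm. 1 (`ker f̂ = (ker f)^D ⊆ Â[n]`) for the two-step descent.
[cite: MumfordAV1970, §15 Thm. 1 (p. 143)] [cite: MilneAV2008, I §9] -/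
theorem pow_eq_one_of_nonempty_pullback_mulN_pullbackP_iso_unit
    (hD : Nonempty ((Scheme.Modules.pullback (unitHatSlice D)).obj D.P ≅ SheafOfModules.unit _))
    (c : Over.mk f ⟶ D.hat.X) (n : ℕ)
    (hc : Nonempty ((Scheme.Modules.pullback ((A.baseChange f).mulN n).left).obj (D.pullbackP f c.left (Over.w c)) ≅
      SheafOfModules.unit _)) :
    c ^ n = 1 := by
  obtain ⟨e⟩ := D.nonempty_pullback_mulN_baseChange_pullbackP_iso hD f c n
  obtain ⟨i⟩ := hc
  exact D.eq_one_of_nonempty_pullbackP_iso_unit f hD (c ^ n) ⟨e.symm ≪≫ i⟩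

/-- **(K2) with an explicit factorisation `ψ ≫ π = [n]_A` through any `S`-scheme `C`** (e.g. `C = A/K`, `ψ = quotientMk`,
`π = mulNDesc`, ★ `quotientMk_comp_mulNDesc`): if `π_T^*(1_A × c)^*𝒫 ≅ 𝒪` on `C_T` then `cⁿ = 1` — pull back along `ψ_T` and use
`ψ_T ≫ π_T = [n]_{A_T}` (`baseChangeHom_mulN`). [cite: MumfordAV1970, §15 Thm. 1 (p. 143)] -/
theorem pow_eq_one_of_nonempty_pullback_factor_iso_unit
    (hD : Nonempty ((Scheme.Modules.pullback (unitHatSlice D)).obj D.P ≅ SheafOfModules.unit _))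
    (c : Over.mk f ⟶ D.hat.X) (n : ℕ) {C : Over S} (ψ : A.X ⟶ C) (π : C ⟶ A.X) (hψπ : ψ ≫ π = A.mulN n)
    (hc : Nonempty ((Scheme.Modules.pullback ((Over.pullback f).map π).left).obj (D.pullbackP f c.left (Over.w c)) ≅
      SheafOfModules.unit _)) :
    c ^ n = 1 := by
  obtain ⟨i⟩ := hc
  refine D.pow_eq_one_of_nonempty_pullback_mulN_pullbackP_iso_unit f hD c n ⟨?_⟩
  have h : ((Over.pullback f).map ψ).left ≫ ((Over.pullback f).map π).left = ((A.baseChange f).mulN n).left := by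
    rw [← Over.comp_left, ← Functor.map_comp, hψπ, ← A.baseChangeHom_mulN f n]
  exact ((Scheme.Modules.pullbackCongr h).app _).symm ≪≫ ((Scheme.Modules.pullbackComp _ _).app _).symm ≪≫
    (Scheme.Modules.pullback _).mapIso i ≪≫ RigidifiedLineBundle.pullbackUnitIso _

/-! ## (K1) The ⊗-difference -/

/-- **(K1) ⊗-DIFFERENCE**: for `T`-valued points `a, a′` of `Â` and any morphism `h : X → A_T` (e.g. `h = π_T : (A/K)_T → A_T`, so that
`h^*(1_A × a)^*𝒫 = (1_{A/K} × a)^*𝒩₁` with `𝒩₁ = (π × 1)^*𝒫`): `h^*(1_A × a)^*𝒫 ≅ h^*(1_A × a′)^*𝒫 ⟹ h^*(1_A × a·a′⁻¹)^*𝒫 ≅ 𝒪_X`.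
Proof: `𝒫_a ≅ 𝒫_{a a′⁻¹} ⊗ 𝒫_{a′}` (★ (P-⊗)), so `M := h^*𝒫_a ≅ h^*𝒫_{a a′⁻¹} ⊗ M` and `M ⊗ M^∨ ≅ 𝒪` cancels `M`.
[cite: MumfordAV1970, §8 (pp. 74–75) and §15 Thm. 1 (p. 143)] -/
theorem nonempty_pullback_pullbackP_mul_inv_iso_unit
    (hD : Nonempty ((Scheme.Modules.pullback (unitHatSlice D)).obj D.P ≅ SheafOfModules.unit _))
    (a a' : Over.mk f ⟶ D.hat.X) {X : Scheme.{u}} (h : X ⟶ (A.baseChange f).left)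
    (e : Nonempty ((Scheme.Modules.pullback h).obj (D.pullbackP f a.left (Over.w a)) ≅
      (Scheme.Modules.pullback h).obj (D.pullbackP f a'.left (Over.w a')))) :
    Nonempty ((Scheme.Modules.pullback h).obj (D.pullbackP f (a * a'⁻¹).left (Over.w _)) ≅ SheafOfModules.unit _) := by
  obtain ⟨e⟩ := e
  obtain ⟨m⟩ := D.nonempty_pullbackP_mul_iso hD f (a * a'⁻¹) a'
  have hc : D.pullbackP f ((a * a'⁻¹) * a').left (Over.w _) = D.pullbackP f a.left (Over.w a) :=
    D.pullbackP_congr f (by rw [inv_mul_cancel_right]) _ _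
  rw [hc] at m
  -- ranks
  have r₁ : HasRank ((Scheme.Modules.pullback h).obj (D.pullbackP f (a * a'⁻¹).left (Over.w _))) 1 :=
    hasRank_pullback _ (D.hasRank_one_pullbackP f _ (Over.w _))
  have r₂ : HasRank ((Scheme.Modules.pullback h).obj (D.pullbackP f a'.left (Over.w a'))) 1 :=
    hasRank_pullback _ (D.hasRank_one_pullbackP f _ (Over.w _))
  -- `M ≅ h^*𝒫_{a a′⁻¹} ⊗ M` with `M := h^*𝒫_{a′}`
  have key : (Scheme.Modules.pullback h).obj (D.pullbackP f a'.left (Over.w a')) ≅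
      tensorObj ((Scheme.Modules.pullback h).obj (D.pullbackP f (a * a'⁻¹).left (Over.w _)))
        ((Scheme.Modules.pullback h).obj (D.pullbackP f a'.left (Over.w a'))) :=
    e.symm ≪≫ (Scheme.Modules.pullback h).mapIso m ≪≫
      pullbackTensorIso h (HasRank.isFiniteLocallyFree' (D.hasRank_one_pullbackP f _ (Over.w _)))
        (HasRank.isFiniteLocallyFree' (D.hasRank_one_pullbackP f _ (Over.w _)))
  -- cancel `M` with `M^∨`
  obtain ⟨u⟩ := nonempty_tensorObj_dual_iso_unitModule r₂
  obtain ⟨as⟩ := nonempty_tensorObj_assoc_iso r₁ r₂ (hasRank_dual r₂)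
  exact ⟨(tensorUnitRightIso _).symm ≪≫ tensorMapIso (Iso.refl _) u.symm ≪≫ as.symm ≪≫ tensorMapIso key.symm (Iso.refl _) ≪≫ u⟩

end DualPair

end AbelianSchemeOver

end Literature.AlgebraicGeometry.AbelianSchemes

end
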